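import Summits.BirchSwinnertonDyer.BirchSwinnertonDyer.Theorems.KolyvaginRoadThreeCruxIffLeaf
import HarnessLib

/-!
# Route `KolyvaginRoadThree`: the DECIDING CRUX FOLLOWS FROM THE RUNG LEAF — `X11b.MultiplicativeRankOneAtThree ⟹
# ZhangSharpFrameAtThreeHL` modulo the published inputs (item stmt-BirchSwinnertonDyer-19574)
# (cell `bsd-stepL`, seat `bsd-stepL-zhang3-p1` g3; `--supports stmt-BirchSwinnertonDyer-19574`, helper)

THEOREMS ONLY (no definition, no named fact, no `sorry`); the leaf and the crux are HYPOTHESIS ∕ CONCLUSION, neither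
is asserted. PARTITION: O2@3 (B10) × A1 (1 116 TRUE-OPEN classes; cw 248 943) — types-the-object-of; closes: none.

THE POINT (route comparison, D-0019 §6): the rung-K2@3 leaf `X11b.MultiplicativeRankOneAtThree` (`∀ W, ClassX11b W 3 →
BSDp W 3`) is the CLOSES_TARGET of all three K2@3 routes. By `zhangSharpFrameAtThreeHL_of_bsdp_onA1` (p431973) the
deciding crux of `KolyvaginRoadThree` is a CONSEQUENCE of the leaf, modulo published inputs: any proof of the leaf —
through `ClassRecordThree` (Schneider + BDP∕IMC at 3), through `ErratumRoadFive`'s twin, or otherwise — proves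
19574; and `KolyvaginRoadThree`'s `closes` goes the other way. So on atom A1 the Kolyvagin road asks for NOTHING
beyond the leaf (while `ClassRecordThree`'s `SchneiderAtThree` ∕ `HalvesAtThree` restricted to A1 are, as far as
the tree knows, STRICTLY STRONGER inputs: no converse from `BSDp W 3` to Schneider's non-degeneracy or to the
anticyclotomic main-conjecture divisibility is in the tree or in print).

* `zhangSharpFrameAtThreeHL_of_multiplicativeRankOneAtThree` — leaf ⟹ deciding crux (mod PUB).
* `multiplicativeRankOneAtThree_onA1_iff_zhangSharpFrameAtThreeHL` — on A1 the leaf and the crux coincide (mod PUB).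

References (locators only): [cite: WZhang2014, Thm. 1.1, Remark 5 and Thm. 10.2] [cite: McCallumLMS1991, §5 Cor. 5.6]
[cite: JetchevSkinnerWan2017, §7.4.4 (v)].
-/

noncomputable section

open scoped Classical

namespace Summit.BirchSwinnertonDyer.BirchSwinnertonDyer.Theorems

open WeierstrassCurve NumberField Literature.NumberTheory.EllipticCurves
  Literature.NumberTheory.EllipticCurves.ModularForms
  Literature.NumberTheory.EllipticCurves.Rank1Residual
  Summit.BirchSwinnertonDyer.Rank1Residual Summit.BirchSwinnertonDyer.Rank1Residual.X11b
  Summit.BirchSwinnertonDyer.BirchSwinnertonDyer.Theses.KolyvaginRoadThree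

/-- **The rung leaf implies the deciding crux of `KolyvaginRoadThree`** (modulo the published inputs of
`zhangSharpFrameAtThreeHL_of_bsdp_onA1`: Gross–Zagier, Kolyvagin, Skinner 2016 Thm. C, GZK, modularity, Shimura
reciprocity at conductor 1, Gross 1991 §3 ×2, McCallum Cor. 5.6 divisibility half): `X11b.MultiplicativeRankOneAtThree →
ZhangSharpFrameAtThreeHL`. CONDITIONAL on every binder; the leaf is a HYPOTHESIS; nothing is booked.
[cite: WZhang2014, Remark 5 and Thm. 10.2] [cite: McCallumLMS1991, §5 Cor. 5.6] -/
theorem zhangSharpFrameAtThreeHL_of_multiplicativeRankOneAtThree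
    (hGZ : ∀ (N : ℕ) [NeZero N] (W : WeierstrassCurve ℚ) (K : Type) [Field K] [NumberField K],
      gross_zagier N W K)
    (hKo : ∀ (N : ℕ) [NeZero N] (W : WeierstrassCurve ℚ) (K : Type) [Field K] [NumberField K],
      kolyvagin N W K)
    (hSk : Skinner2016.thmC_padicValRat_bsd_rank_zero)
    (hGZK : rank_eq_analyticRank_of_analyticRank_le_one) (hmod : hasEntireLFunction_rat)
    (hrec : ∀ (N : ℕ) [NeZero N] (W : WeierstrassCurve ℚ) (K : Type) [Field K] [NumberField K],
      heegnerPointOfConductor_one_galoisConj N W K)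
    (h1 : ∀ (N : ℕ) [NeZero N] (W : WeierstrassCurve ℚ) (K : Type) [Field K] [NumberField K],
      phi_heegnerPointOfConductor_mem_range_map_ringClassField N W K)
    (h2 : ∀ (K : Type) [Field K] [NumberField K], exists_generator_ringClassGalOver K)
    (hMcU : McCallum1991_padicValNat_card_sha_primary_add_le_of_globalDivisibility)
    (hleaf : Summit.BirchSwinnertonDyer.Rank1Residual.X11b.MultiplicativeRankOneAtThree) :
    ZhangSharpFrameAtThreeHL :=
  zhangSharpFrameAtThreeHL_of_bsdp_onA1 hGZ hKo hSk hGZK hmod hrec h1 h2 hMcU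
    (fun W _ _ hX _hram _htam ↦ hleaf W hX)

/-- **On atom A1 the rung leaf and the deciding crux COINCIDE** (modulo the published inputs of both directions):
`(∀ W, ClassX11b W 3 → Ram W 3 → ¬ 3 ∣ ∏c → BSDp W 3) ↔ ZhangSharpFrameAtThreeHL` — the symmetric reading of
`zhangSharpFrameAtThreeHL_iff_bsdp_onA1` (p431973), recorded with the leaf's restriction on the LEFT for route
comparison. CONDITIONAL on every binder; nothing is booked. [cite: WZhang2014, Thm. 1.1 and Remark 5]
[cite: McCallumLMS1991, §5 Cor. 5.6] -/
theorem multiplicativeRankOneAtThree_onA1_iff_zhangSharpFrameAtThreeHL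
    (hGZ : ∀ (N : ℕ) [NeZero N] (W : WeierstrassCurve ℚ) (K : Type) [Field K] [NumberField K],
      gross_zagier N W K)
    (hKo : ∀ (N : ℕ) [NeZero N] (W : WeierstrassCurve ℚ) (K : Type) [Field K] [NumberField K],
      kolyvagin N W K)
    (hB : ∀ (N : ℕ) [NeZero N] (W : WeierstrassCurve ℚ) (K : Type) [Field K] [NumberField K],
      Kolyvagin1990_padicValNat_card_sha_le N W K)
    (hSk : Skinner2016.thmC_padicValRat_bsd_rank_zero)
    (hGZK : rank_eq_analyticRank_of_analyticRank_le_one) (hmod : hasEntireLFunction_rat)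
    (hnf : exists_isNewformOf) (hHL : HoffsteinLuo1997_exists_twist_L_one_ne_zero)
    (hMaz : mazur_not_dvd_maninConstant_of_odd)
    (hrec : ∀ (N : ℕ) [NeZero N] (W : WeierstrassCurve ℚ) (K : Type) [Field K] [NumberField K],
      heegnerPointOfConductor_one_galoisConj N W K)
    (hMc : McCallum1991_pow_dvd_card_sha_primary_of_certificate)
    (hMcU : McCallum1991_padicValNat_card_sha_primary_add_le_of_globalDivisibility)
    (h1 : ∀ (N : ℕ) [NeZero N] (W : WeierstrassCurve ℚ) (K : Type) [Field K] [NumberField K],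
      phi_heegnerPointOfConductor_mem_range_map_ringClassField N W K)
    (h2 : ∀ (K : Type) [Field K] [NumberField K], exists_generator_ringClassGalOver K) :
    (∀ (W : WeierstrassCurve ℚ) [W.IsElliptic] [W.IsGloballyMinimal],
        ClassX11b W 3 → Ram W 3 → ¬ 3 ∣ W.tamagawaProduct → BSDp W 3) ↔ ZhangSharpFrameAtThreeHL :=
  (zhangSharpFrameAtThreeHL_iff_bsdp_onA1 hGZ hKo hB hSk hGZK hmod hnf hHL hMaz hrec hMc hMcU h1 h2).symm

end Summit.BirchSwinnertonDyer.BirchSwinnertonDyer.Theorems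

end
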